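import Summits.AtomisticToContinuum.BoseEinsteinCondensation.Theorems.BoxCountShadowRingShare
import Summits.AtomisticToContinuum.BoseEinsteinCondensation.Theorems.BoxLatticeFSumSuperBlockOccupation
import Literature.Probability.LatticeModels.IntersectionSecondMoment
import HarnessLib

/-!
# BoxCountShadowSiblingMap — the dyadic sibling map, children of a coarse cell, and the disjoint-union geometry

Part 1 of 2 of lens-6 g36's `BoxCountShadowSiblingCoherence` (file 9 of the DISP dossier, sha256 40f80ff6…), split for the
400-line rule at the «Step 1» boundary by hand-2 g14 (bodies byte-identical; 16 one-line docstrings added for the gate's lint; two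
elementary `ℝ≥0∞` lemmas deleted for the gate's dedup in favour of the tree's `Current.two_mul_mul_le_sq_add_sq` and
`CoarseGrainedReverseHolder.PartitionComparison.sq_sum_le_card_mul_sum_sq`).
Content: elementary `ℝ≥0∞` inequalities, the sibling involution `sibFin` / `sib` / `sibEquiv` (flip the lowest binary digit of
coordinate 0), `children K P` / `parent`, and the decomposition of a coarse cell into its (≤ 8) children.  Steps 1–2 (sibling
coherence from parent-scale condensation; the pair-mass bound on bad fibres) are in `BoxCountShadowSiblingCoherence`.
No instances, no notation, no sorry.
-/

noncomputable section

open MeasureTheory Filter Set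
open scoped ENNReal NNReal BigOperators

namespace Summit.AtomisticToContinuum.BoseEinsteinCondensation.Theorems.BoxCountShadow

open Literature.MathematicalPhysics.QuantumManyBody.BoseGas
open Summit.AtomisticToContinuum.BoseEinsteinCondensation.Theorems.BoxLatticeFSum
open Summit.AtomisticToContinuum.BoseEinsteinCondensation.Theorems.BoxLabelAffinity
open Summit.AtomisticToContinuum.BoseEinsteinCondensation.Theorems.BoxHorizonAffinity

variable {n : ℕ}

/-! ### Elementary inequalities in `ℝ≥0∞` -/

/-- `8ab ≤ 16a² + b²` in `ℝ≥0∞` (AM–GM with weight `4`). [folklore] -/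
theorem ennreal_eight_mul_mul_le (a b : ℝ≥0∞) : 8 * (a * b) ≤ 16 * a ^ 2 + b ^ 2 := by
  -- (the tree's `Literature.Probability.LatticeModels.Current.two_mul_mul_le_sq_add_sq`, gate dedup)
  have h := Literature.Probability.LatticeModels.Current.two_mul_mul_le_sq_add_sq (4 * a) b
  calc 8 * (a * b) = 2 * (4 * a * b) := by ring
    _ ≤ (4 * a) ^ 2 + b ^ 2 := h
    _ = 16 * a ^ 2 + b ^ 2 := by ring

/-- Cancellation of a finite nonzero factor in `ℝ≥0∞`. [folklore] -/
theorem ennreal_le_of_mul_le_mul_left {a b c : ℝ≥0∞} (h0 : a ≠ 0) (ht : a ≠ ⊤) (h : a * b ≤ a * c) :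
    b ≤ c := by
  calc b = a⁻¹ * (a * b) := by rw [← mul_assoc, ENNReal.inv_mul_cancel h0 ht, one_mul]
    _ ≤ a⁻¹ * (a * c) := mul_le_mul' le_rfl h
    _ = c := by rw [← mul_assoc, ENNReal.inv_mul_cancel h0 ht, one_mul]

/-! ### The dyadic sibling map -/

/-- The sibling index along one axis: flip the lowest binary digit (an involution for even `K`). [folklore] -/
def sibFin {K : ℕ} (t : Fin K) : Fin K :=
  if (t : ℕ) % 2 = 0 then
    (if h2 : (t : ℕ) + 1 < K then ⟨(t : ℕ) + 1, h2⟩ else t)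
  else ⟨(t : ℕ) - 1, lt_of_le_of_lt (Nat.sub_le _ _) t.isLt⟩

/-- The dyadic SIBLING cell `σ B` of `B` (flip the lowest binary digit of the first index). [folklore] -/
def sib {K : ℕ} (B : SubIdx K) : SubIdx K := Function.update B 0 (sibFin (B 0))

/-- The value of the sibling index: `t + 1` for even `t`, `t − 1` for odd `t` (for even `K`). -/
theorem sibFin_val {K : ℕ} (hK : Even K) (t : Fin K) :
    ((sibFin t : ℕ) = (t : ℕ) + 1 ∧ (t : ℕ) % 2 = 0) ∨ ((sibFin t : ℕ) = (t : ℕ) - 1 ∧ (t : ℕ) % 2 = 1) := by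
  unfold sibFin
  split_ifs with h h2
  · left; exact ⟨rfl, h⟩
  · exfalso
    obtain ⟨k, hk⟩ := hK
    have := t.isLt
    omega
  · right; exact ⟨rfl, by omega⟩

/-- The sibling index differs from the index (even `K`). -/
theorem sibFin_ne {K : ℕ} (hK : Even K) (t : Fin K) : sibFin t ≠ t := by
  intro h
  have hv : (sibFin t : ℕ) = (t : ℕ) := by rw [h]
  rcases sibFin_val hK t with ⟨h1, h2⟩ | ⟨h1, h2⟩ <;> omega

/-- An index and its sibling have the same parent digit `⌊·/2⌋`. -/
theorem sibFin_div_two {K : ℕ} (hK : Even K) (t : Fin K) : (sibFin t : ℕ) / 2 = (t : ℕ) / 2 := by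
  rcases sibFin_val hK t with ⟨h1, h2⟩ | ⟨h1, h2⟩ <;> omega

/-- The sibling map on `Fin K` is an involution (even `K`). -/
theorem sibFin_sibFin {K : ℕ} (hK : Even K) (t : Fin K) : sibFin (sibFin t) = t := by
  apply Fin.ext
  rcases sibFin_val hK t with ⟨h1, h2⟩ | ⟨h1, h2⟩ <;>
    rcases sibFin_val hK (sibFin t) with ⟨h3, h4⟩ | ⟨h3, h4⟩ <;> omega

/-- An index and its sibling are adjacent (differ by at most one). -/
theorem sibFin_adj {K : ℕ} (hK : Even K) (t : Fin K) :
    (t : ℕ) ≤ (sibFin t : ℕ) + 1 ∧ (sibFin t : ℕ) ≤ (t : ℕ) + 1 := by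
  rcases sibFin_val hK t with ⟨h1, h2⟩ | ⟨h1, h2⟩ <;> omega

/-- The sibling cell's first coordinate is the sibling of the first coordinate. -/
theorem sib_apply_zero {K : ℕ} (B : SubIdx K) : sib B 0 = sibFin (B 0) := by
  rw [sib, Function.update_self]

/-- The sibling cell agrees with the cell in every coordinate other than the first. -/
theorem sib_apply_ne {K : ℕ} (B : SubIdx K) {i : Fin 3} (hi : i ≠ 0) : sib B i = B i := by
  rw [sib, Function.update_of_ne hi]

/-- `σ` is an involution (even `K`). [folklore] -/
theorem sib_sib {K : ℕ} (hK : Even K) (B : SubIdx K) : sib (sib B) = B := by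
  funext i
  by_cases hi : i = 0
  · subst hi
    rw [sib_apply_zero, sib_apply_zero, sibFin_sibFin hK]
  · rw [sib_apply_ne _ hi, sib_apply_ne _ hi]

/-- The sibling map on cells is injective (even `K`). -/
theorem sib_injective {K : ℕ} (hK : Even K) : Function.Injective (sib (K := K)) :=
  (Function.LeftInverse.injective (g := sib) fun B => sib_sib hK B)

/-- `σ B ≠ B` (even `K`). [folklore] -/
theorem sib_ne {K : ℕ} (hK : Even K) (B : SubIdx K) : sib B ≠ B := by
  intro h
  have h0 := congrFun h 0
  rw [sib_apply_zero] at h0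
  exact sibFin_ne hK (B 0) h0

/-- `σ B` is an `ℓ^∞`-neighbour of `B` (even `K`). [folklore] -/
theorem sib_mem_nbrs {K : ℕ} (hK : Even K) (B : SubIdx K) : sib B ∈ nbrs B := by
  refine ⟨sib_ne hK B, fun i => ?_⟩
  by_cases hi : i = 0
  · subst hi
    rw [sib_apply_zero]
    exact sibFin_adj hK (B 0)
  · rw [sib_apply_ne _ hi]
    exact ⟨Nat.le_succ _, Nat.le_succ _⟩

/-- `σ` preserves the dyadic parent. [folklore] -/
theorem sib_div_two {K : ℕ} (hK : Even K) (B : SubIdx K) (j : Fin 3) : (sib B j : ℕ) / 2 = (B j : ℕ) / 2 := by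
  by_cases hj : j = 0
  · subst hj
    rw [sib_apply_zero]
    exact sibFin_div_two hK (B 0)
  · rw [sib_apply_ne _ hj]

/-- `σ` as a permutation of the cells (even `K`). [folklore] -/
def sibEquiv {K : ℕ} (hK : Even K) : SubIdx K ≃ SubIdx K :=
  ⟨sib, sib, sib_sib hK, sib_sib hK⟩

/-- Unfolding lemma for the sibling equivalence. -/
theorem sibEquiv_apply {K : ℕ} (hK : Even K) (B : SubIdx K) : sibEquiv hK B = sib B := rfl

/-- Reindexing by the sibling permutation: `Σ_B f (σ B) = Σ_B f B`. [folklore] -/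
theorem sum_comp_sib {K : ℕ} (hK : Even K) (f : SubIdx K → ℝ≥0∞) : ∑ B, f (sib B) = ∑ B, f B :=
  Equiv.sum_comp (sibEquiv hK) f

/-! ### Dyadic children of a coarse cell -/

/-- The dyadic CHILDREN (in the `K`-grid) of a coarse cell `P` of the `K'`-grid. [folklore] -/
def children (K : ℕ) {K' : ℕ} (P : SubIdx K') : Finset (SubIdx K) :=
  (Finset.univ : Finset (SubIdx K)).filter (fun C => ∀ j : Fin 3, (C j : ℕ) / 2 = (P j : ℕ))

/-- Membership in `children K P`: every coordinate has parent digit `P j`. -/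
theorem mem_children {K K' : ℕ} {P : SubIdx K'} {C : SubIdx K} :
    C ∈ children K P ↔ ∀ j : Fin 3, (C j : ℕ) / 2 = (P j : ℕ) := by
  simp [children]

/-- The sibling of a child of `P` is a child of `P` (even `K`). -/
theorem sib_mem_children {K K' : ℕ} (hK : Even K) {P : SubIdx K'} {C : SubIdx K} (hC : C ∈ children K P) :
    sib C ∈ children K P := by
  rw [mem_children] at hC ⊢
  intro j
  rw [sib_div_two hK]
  exact hC j

/-- A coarse cell has at most eight children. -/
theorem card_children_le_eight {K K' : ℕ} (P : SubIdx K') : (children K P).card ≤ 8 :=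
  card_children_le P

/-- Sibling reindexing inside one family: `Σ_{C child} f C ≤ Σ_{C child} f (σ C)`. [folklore] -/
theorem sum_children_le_sum_children_sib {K K' : ℕ} (hK : Even K) (P : SubIdx K') (f : SubIdx K → ℝ≥0∞) :
    ∑ C ∈ children K P, f C ≤ ∑ C ∈ children K P, f (sib C) := by
  classical
  have hinj : Set.InjOn (sib (K := K)) ↑(children K P) := (sib_injective hK).injOn
  calc ∑ C ∈ children K P, f C = ∑ C ∈ children K P, f (sib (sib C)) := by
        refine Finset.sum_congr rfl fun C _ => ?_; rw [sib_sib hK]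
    _ = ∑ D ∈ (children K P).image sib, f (sib D) :=
        (Finset.sum_image (f := fun D => f (sib D)) hinj).symm
    _ ≤ ∑ D ∈ children K P, f (sib D) := by
        refine Finset.sum_le_sum_of_subset fun D hD => ?_
        obtain ⟨C, hC, rfl⟩ := Finset.mem_image.1 hD
        exact sib_mem_children hK hC

/-- The parent (in the `K'`-grid) of a cell of the `2K'`-grid. [folklore] -/
def parent {K' : ℕ} (C : SubIdx (2 * K')) : SubIdx K' :=
  fun j => ⟨(C j : ℕ) / 2, by have := (C j).isLt; omega⟩

/-- Every fine cell is a child of its parent. -/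
theorem mem_children_parent {K' : ℕ} (C : SubIdx (2 * K')) : C ∈ children (2 * K') (parent C) := by
  rw [mem_children]; intro j; rfl

/-- `parent C = P` iff `C` is a child of `P`. -/
theorem parent_eq_iff {K' : ℕ} (C : SubIdx (2 * K')) (P : SubIdx K') :
    parent C = P ↔ C ∈ children (2 * K') P := by
  rw [mem_children]
  constructor
  · rintro rfl j; rfl
  · intro h; funext j; exact Fin.ext (h j)

/-- Summing over all fine cells = summing over coarse cells and their children. [folklore] -/
theorem sum_eq_sum_children {K' : ℕ} (f : SubIdx (2 * K') → ℝ≥0∞) :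
    ∑ C, f C = ∑ P : SubIdx K', ∑ C ∈ children (2 * K') P, f C := by
  classical
  rw [← Finset.sum_fiberwise_of_maps_to (s := Finset.univ) (t := Finset.univ) (g := parent)
    (fun C _ => Finset.mem_univ _) f]
  refine Finset.sum_congr rfl fun P _ => ?_
  refine Finset.sum_congr ?_ fun _ _ => rfl
  ext C
  simp only [Finset.mem_filter, Finset.mem_univ, true_and, parent_eq_iff]

/-! ### Geometry: a coarse cell is the disjoint union of its children -/

/-- The coarse side length is twice the fine one: `L / K' = 2 · (L / (2K'))`. -/
theorem coarse_side {L : ℝ} {K' : ℕ} (hK' : 0 < K') :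
    L / (K' : ℝ) = 2 * (L / ((2 * K' : ℕ) : ℝ)) := by
  have hK'r : (K' : ℝ) ≠ 0 := by exact_mod_cast hK'.ne'
  push_cast
  field_simp

/-- The sub-cells of the children of a coarse cell are pairwise disjoint. -/
theorem children_pairwiseDisjoint {K K' : ℕ} {ℓ : ℝ} (hℓ : 0 < ℓ) (P : SubIdx K') :
    (↑(children K P) : Set (SubIdx K)).PairwiseDisjoint (fun C => subCell ℓ C) := by
  intro C _ C' _ hne
  exact Set.disjoint_left.2 fun x hx hx' => not_mem_subCell_of_ne hℓ hne hx hx'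

/-- `subCell (2ℓ) P = ⋃_{C child of P} subCell ℓ C` in the `2K'`-grid. [folklore] -/
theorem subCell_coarse_eq_biUnion {K' : ℕ} {ℓ : ℝ} (hℓ : 0 < ℓ) (P : SubIdx K') :
    subCell (2 * ℓ) P = ⋃ C ∈ children (2 * K') P, subCell ℓ C := by
  apply Set.Subset.antisymm
  · intro x hx
    have hxcell : x ∈ cell (((2 * K' : ℕ) : ℝ) * ℓ) := by
      have h := subCell_subset_cell (mul_pos two_pos hℓ) P hx
      have e : (K' : ℝ) * (2 * ℓ) = ((2 * K' : ℕ) : ℝ) * ℓ := by push_cast; ring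
      rw [e] at h; exact h
    obtain ⟨C, hC⟩ := exists_mem_subCell hℓ hxcell
    have hchild : ∀ j : Fin 3, (C j : ℕ) / 2 = (P j : ℕ) := child_of_mem hℓ hC hx
    exact Set.mem_iUnion₂.2 ⟨C, mem_children.2 hchild, hC⟩
  · exact Set.iUnion₂_subset fun C hC => subCell_subset_subCell_double hℓ (mem_children.1 hC)

/-- Set integrals over a coarse cell split over its children. [folklore] -/
theorem setLIntegral_coarse_eq_sum {K' : ℕ} {ℓ : ℝ} (hℓ : 0 < ℓ) (P : SubIdx K') (g : Space → ℝ≥0∞) :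
    ∫⁻ x in subCell (2 * ℓ) P, g x = ∑ C ∈ children (2 * K') P, ∫⁻ x in subCell ℓ C, g x := by
  rw [subCell_coarse_eq_biUnion hℓ P]
  exact lintegral_biUnion_finset (children_pairwiseDisjoint hℓ P) (fun C _ => measurableSet_subCell ℓ C) g

/-- Coarse block mass = sum of the children's block masses. [folklore] -/
theorem blockMass_coarse_eq_sum {L : ℝ} {K' : ℕ} (hL : 0 < L) (hK' : 0 < K') (Φ : Config (n + 1) → ℝ)
    (P : SubIdx K') (Y : Config n) :
    blockMass L K' Φ P Y = ∑ C ∈ children (2 * K') P, blockMass L (2 * K') Φ C Y := by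
  have hKr : (0 : ℝ) < ((2 * K' : ℕ) : ℝ) := by exact_mod_cast (by omega : 0 < 2 * K')
  have hℓ : 0 < L / ((2 * K' : ℕ) : ℝ) := div_pos hL hKr
  unfold blockMass
  rw [coarse_side hK']
  exact setLIntegral_coarse_eq_sum hℓ P _

/-- Coarse block amplitude = `8^{-1/2}` × sum of the children's block amplitudes. [folklore] -/
theorem blockAmp_coarse_eq_sum {L : ℝ} {K' : ℕ} (hL : 0 < L) (hK' : 0 < K') (Φ : Config (n + 1) → ℝ)
    (P : SubIdx K') (Y : Config n) :
    blockAmp L K' Φ P Y =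
      ENNReal.ofReal ((Real.sqrt 8)⁻¹) * ∑ C ∈ children (2 * K') P, blockAmp L (2 * K') Φ C Y := by
  have hKr : (0 : ℝ) < ((2 * K' : ℕ) : ℝ) := by exact_mod_cast (by omega : 0 < 2 * K')
  set ℓ := L / ((2 * K' : ℕ) : ℝ) with hℓdef
  have hℓ : 0 < ℓ := div_pos hL hKr
  have hsq : (Real.sqrt ((2 * ℓ) ^ 3))⁻¹ = (Real.sqrt 8)⁻¹ * (Real.sqrt (ℓ ^ 3))⁻¹ := by
    rw [show (2 * ℓ) ^ 3 = 8 * ℓ ^ 3 by ring, Real.sqrt_mul (by norm_num : (0:ℝ) ≤ 8), mul_inv]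
  unfold blockAmp
  rw [coarse_side hK', ← hℓdef, setLIntegral_coarse_eq_sum hℓ P, hsq,
    ENNReal.ofReal_mul (inv_nonneg.2 (Real.sqrt_nonneg _)), mul_assoc, Finset.mul_sum]

/-- `8 · (8^{-1/2})² = 1` in `ℝ≥0∞`. [folklore] -/
theorem eight_mul_ofReal_inv_sqrt_eight_sq :
    (8 : ℝ≥0∞) * ENNReal.ofReal ((Real.sqrt 8)⁻¹) ^ 2 = 1 := by
  rw [← ENNReal.ofReal_pow (inv_nonneg.2 (Real.sqrt_nonneg _)), inv_pow,
    Real.sq_sqrt (by norm_num : (0:ℝ) ≤ 8), ← one_div,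
    ENNReal.ofReal_div_of_pos (by norm_num : (0:ℝ) < 8), ENNReal.ofReal_one, ENNReal.ofReal_ofNat,
    ENNReal.mul_div_cancel (by norm_num) ENNReal.ofNat_ne_top]

end Summit.AtomisticToContinuum.BoseEinsteinCondensation.Theorems.BoxCountShadow

end
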